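import Literature.NumberTheory.DiophantineGeometry.GenEllThm38
import Literature.NumberTheory.DiophantineGeometry.GenEllFullGaloisCorollaries
import Literature.NumberTheory.EllipticCurves.MultiplicativeReductionTransvectionRamifiedProofs
import HarnessLib

/-!
# [GenEll] Theorem 3.8 (Full Special Linear Galois Actions) — UNCONDITIONAL

S. Mochizuki, *Arithmetic elliptic curves in general position*, Math. J. Okayama Univ. **52** (2010)
[cite: MochizukiGenEll2010], Theorem 3.8 and its proof, pp. 19–20; named statement `GenEll_thm38`
(`GenEllFullGalois.lean`, abc-iut-S4).

The tree's `GenEll_thm38_of_localTransvection` (`GenEllThm38.lean`, abc-iut-S-d4) proves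
`GenEll_thm38` from the printed ingredients modulo ONE local input `hγ`: an element of order `l` in
the image of Galois on `E[l]` at a prime `w ∣ l` of multiplicative reduction with `l ∤ h_w` ("the
discussion of the local theory preceding Lemma 3.2", p. 20; Silverman, *ATAEC*, V.6 Prop. 6.1 at the
residue characteristic).  That input is now the tree theorem
`WeierstrassCurve.exists_orderOf_galoisRepTorsion_eq_of_hasMultiplicativeReductionAt_of_mem`
(`MultiplicativeReductionTransvectionRamifiedProofs.lean`, abc-iut-w4-d057: the Tate-form argument of
`MultiplicativeReductionTransvectionProofs` with an ARBITRARY uniformiser, i.e. no restriction on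
`e(w ∣ l)`), valid for ODD `l` — and the proof of Theorem 3.8 only ever needs it at a prime
`l ≥ 5` (condition (a) forces `l ≥ 2304000`, condition (b) has `l` prime to `30`).  This file
re-runs S-d4's assembly verbatim with the bound `5 ≤ l` established BEFORE the order-`l` step and
the hypothesis `hγ` replaced by that theorem:

* `GenEll_thm38_holds : GenEll_thm38` — **[GenEll] Theorem 3.8, kernel-proved with no residual
  hypothesis** (all inputs are tree theorems: Lemma 3.7 `GenEll_lemma37_holds`, Prop. 3.4,
  `exists_torsion15Field` (`L′ = L(E[15])`), the base-change transports of abc-iut-S-d3, (P6)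
  `imageModLContainsSL2_of_not_admitsLCyclic_of_orderOf_eq`, Lemma 3.1 (iv)
  `lAdicImageContainsSL2_of_imageModLContainsSL2`, the descent `lAdicImageContainsSL2_of_baseChange`,
  and the two transvection theorems at `w ∤ l` (abc-iut-S5) / `w ∣ l` (this seat));
* `GenEll_cor43_holds : GenEll_cor43`, `GenEll_cor44_holds : GenEll_cor44` — **[GenEll] Corollaries
  4.3 and 4.4 (Full Galois Actions for Degenerating Elliptic Curves / for Compactly Bounded Subsets),
  unconditional**, by S-d3's `GenEll_cor43_of_thm38` / `GenEll_cor44_of_thm38`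
  (`GenEllFullGaloisCorollaries.lean`: Thm. 3.8 + Lemma 4.1 primes of prescribed size + Lemma 4.2 +
  the cyclotomic surjectivity at `l ∤ disc L`).

Proof-only; no definitions; the three private arithmetic helpers are restated from `GenEllThm38.lean`
(they are `private` there).  DAG nodes `GenEll:Thm3.8`, `GenEll:Cor4.3`, `GenEll:Cor4.4`.  Classical, undisputed material (Scholze–Stix
2018 §1.2); nothing here bears on [IUTchIII] Cor. 3.12.
-/

noncomputable section

open scoped Classical
open NumberField IsDedekindDomain

namespace Literature.NumberTheory.DiophantineGeometry.GenEll

/-- Real bookkeeping of "if `E_L` and `l` satisfy condition (a) of Theorem 3.8, then `E_{L′}` and `l`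
satisfy condition (a) of Lemma 3.7 [perhaps for a different `C`]" (p. 20): with `d′ = k·d`, `1 ≤ k ≤ 23040`
and `C ≥ C₇·23040^ε`, `23040·100·d·(h + C·d^ε) ≤ l` implies `100·d′·(h + C₇·d′^ε) ≤ l`.
[cite: MochizukiGenEll2010, Thm 3.8 p.20] -/
private theorem condA_transfer {ε C₇ C h d k l : ℝ} (hε : 0 < ε) (hC₇ : 0 < C₇)
    (hC : C₇ * (23040 : ℝ) ^ ε ≤ C) (hk1 : 1 ≤ k) (hk : k ≤ 23040) (hd : 1 ≤ d) (hl0 : 0 ≤ l)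
    (hl : 23040 * 100 * d * (h + C * d ^ ε) ≤ l) :
    100 * (k * d) * (h + C₇ * (k * d) ^ ε) ≤ l := by
  have hd0 : 0 ≤ d := by linarith
  have hk0 : 0 ≤ k := by linarith
  have hkd : (k * d) ^ ε = k ^ ε * d ^ ε := Real.mul_rpow hk0 hd0
  have hkε : k ^ ε ≤ (23040 : ℝ) ^ ε := Real.rpow_le_rpow hk0 hk hε.le
  have hdε : 0 ≤ d ^ ε := Real.rpow_nonneg hd0 ε
  have hkε0 : 0 ≤ k ^ ε := Real.rpow_nonneg hk0 ε
  by_cases hneg : h + C₇ * (k * d) ^ ε ≤ 0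
  · have : 100 * (k * d) * (h + C₇ * (k * d) ^ ε) ≤ 0 :=
      mul_nonpos_of_nonneg_of_nonpos (by positivity) hneg
    linarith
  push Not at hneg
  -- `h + C₇ (kd)^ε ≤ h + C d^ε`
  have h1 : C₇ * (k * d) ^ ε ≤ C * d ^ ε := by
    rw [hkd]
    calc C₇ * (k ^ ε * d ^ ε) = (C₇ * k ^ ε) * d ^ ε := by ring
      _ ≤ (C₇ * (23040 : ℝ) ^ ε) * d ^ ε :=
          mul_le_mul_of_nonneg_right (mul_le_mul_of_nonneg_left hkε hC₇.le) hdε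
      _ ≤ C * d ^ ε := mul_le_mul_of_nonneg_right hC hdε
  have h2 : 0 < h + C * d ^ ε := by linarith
  calc 100 * (k * d) * (h + C₇ * (k * d) ^ ε)
      ≤ 100 * (23040 * d) * (h + C₇ * (k * d) ^ ε) := by
        apply mul_le_mul_of_nonneg_right _ hneg.le
        nlinarith
    _ ≤ 100 * (23040 * d) * (h + C * d ^ ε) := by
        apply mul_le_mul_of_nonneg_left (by linarith) (by positivity)
    _ = 23040 * 100 * d * (h + C * d ^ ε) := by ring
    _ ≤ l := hl

/-- A prime coprime to `30` does not divide `23040 = 2⁹·3²·5`, nor any of its divisors.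
[cite: MochizukiGenEll2010, Thm 3.8 p.20] -/
private theorem not_dvd_of_coprime_thirty {l k : ℕ} (hl : l.Prime) (h30 : Nat.Coprime l 30)
    (hk : k ∣ 23040) : ¬ l ∣ k := by
  intro hlk
  have h2 : l ∣ 23040 := hlk.trans hk
  have : l ∣ 2 ^ 9 * 3 ^ 2 * 5 := by norm_num; exact h2
  rcases (Nat.Prime.dvd_mul hl).mp this with h' | h5
  · rcases (Nat.Prime.dvd_mul hl).mp h' with h2' | h3
    · have := (Nat.prime_dvd_prime_iff_eq hl Nat.prime_two).mp (hl.dvd_of_dvd_pow h2')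
      subst this; norm_num at h30
    · have := (Nat.prime_dvd_prime_iff_eq hl Nat.prime_three).mp (hl.dvd_of_dvd_pow h3)
      subst this; norm_num at h30
  · have := (Nat.prime_dvd_prime_iff_eq hl Nat.prime_five).mp h5
    subst this; norm_num at h30

/-- A prime coprime to `30` is `≥ 5` (indeed `≥ 7`). [cite: MochizukiGenEll2010, Thm 3.8 p.19] -/
private theorem five_le_of_coprime_thirty {l : ℕ} (hl : l.Prime) (h30 : Nat.Coprime l 30) : 5 ≤ l := by
  refine hl.five_le_of_ne_two_of_ne_three ?_ ?_
  · rintro rfl; norm_num at h30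
  · rintro rfl; norm_num at h30

/-- **[GenEll] Theorem 3.8 (Full Special Linear Galois Actions), unconditional.**  For `K_V`
compactly bounded and `ε > 0` there are `C > 0` and a Galois-finite `Exc` such that for `[E_L] ∉ Exc`
and a prime `l` with (a) `l ≥ 23040·100·d·(ht_Falt + C·d^ε)` and a prime of potentially
multiplicative reduction, or (b) `[E_L] ∈ K_V`, `l` prime to the local heights at the primes of
potentially multiplicative reduction and to `30`, the image of `Gal(Q̄/L)` in `Aut(E[lⁿ])` contains
the automorphisms of determinant `1` for every `n ≥ 1` — the named statement `GenEll_thm38` of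
`GenEllFullGalois.lean`, PROVED (S-d4's `GenEll_thm38_of_localTransvection` assembly with its one
hypothesis discharged by `exists_orderOf_galoisRepTorsion_eq_of_hasMultiplicativeReductionAt_of_mem`
at `l ≥ 5`). [cite: MochizukiGenEll2010, Thm 3.8 p.19] -/
theorem GenEll_thm38_holds : Literature.NumberTheory.DiophantineGeometry.GenEll.GenEll_thm38 := by
  intro D ε hε
  -- Lemma 3.7 for `(K_V, ε)` and the lower bound `ht_Falt ≥ -K/24` from Prop. 3.4
  obtain ⟨C₇, hC₇, Exc, hExc, h37⟩ := GenEll_lemma37_holds D ε hε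
  obtain ⟨-, ⟨K', hK'⟩, -⟩ := prop34Ineq_of_pos (by norm_num : (0 : ℝ) < 1)
  set K : ℝ := max K' 0 with hKdef
  have hK0 : 0 ≤ K := le_max_right _ _
  have hFalt_lb : ∀ Q : EllPoint, -(K / 24) ≤ Q.htFalt := fun Q => by
    have h1 := hK' Q (Set.mem_univ _)
    have h2 : 0 ≤ Q.htInf := Q.degInf_nonneg.trans Q.degInf_le_htInf
    have h3 : K' ≤ K := le_max_left _ _
    norm_num at h1
    linarith
  have h23040 : 0 < (23040 : ℝ) ^ ε := Real.rpow_pos_of_pos (by norm_num) ε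
  set C : ℝ := C₇ * (23040 : ℝ) ^ ε + K / 24 + 1 with hCdef
  have hCpos : 0 < C := by have := mul_pos hC₇ h23040; rw [hCdef]; positivity
  have hCC₇ : C₇ * (23040 : ℝ) ^ ε ≤ C := by rw [hCdef]; linarith [div_nonneg hK0 (by norm_num : (0:ℝ) ≤ 24)]
  refine ⟨C, hCpos, Exc, hExc, ?_⟩
  intro P l hlF hnot hcond n hn
  have hl : l.Prime := hlF.out
  -- the field `L′ = L(E[15])` and the base-changed presentation `P′`
  obtain ⟨L', hfin, hgal, h3, h5, hdeg⟩ := P.exists_torsion15Field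
  haveI := hfin
  haveI := hgal
  haveI : NumberField L' := NumberField.of_module_finite P.F L'
  let P' : EllPoint := EllPoint.mk L' (P.W.map (algebraMap P.F L'))
  have hss' : P'.IsSemistable := P.isSemistable_mk_map_of_fixingSubgroup_le L' h3 h5
  -- the transports (abc-iut-S-d3)
  have hdeg' : (P'.degree : ℝ) = (Module.finrank P.F L' : ℝ) * P.degree := by
    have h := P.degree_baseChange L'
    exact_mod_cast h
  have hFalt' : P'.htFalt = P.htFalt := P.htFalt_baseChange L'
  have hExc' : ¬ MellExcMem Exc P' := fun h => hnot ((P.mellExcMem_baseChange_iff L' Exc).mp h)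
  have hk1 : (1 : ℝ) ≤ Module.finrank P.F L' := by exact_mod_cast Module.finrank_pos
  have hk : (Module.finrank P.F L' : ℝ) ≤ 23040 := by
    exact_mod_cast Nat.le_of_dvd (by norm_num) hdeg
  have hd : (1 : ℝ) ≤ P.degree := by exact_mod_cast P.degree_pos
  have hl0 : (0 : ℝ) ≤ l := Nat.cast_nonneg _
  -- multiplicative primes of `E_{L′}`: from potentially multiplicative primes (semistability)
  have hmult_of_pot : ∀ w : HeightOneSpectrum (𝓞 L'), P'.IsPotMult w →
      P'.W.HasMultiplicativeReductionAt w := fun w hw => by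
    refine (hss' w).resolve_left fun hgood => ?_
    have := P'.localHeight_nonpos_of_hasGoodReductionAt w hgood
    exact absurd hw (not_lt.mpr this)
  -- Lemma 3.7 for `E_{L′}`
  obtain ⟨h37a, h37b, h37c⟩ := h37 P' l hl hss'
  -- the conditions of Lemma 3.7 for `E_{L′}` from those of Theorem 3.8 for `E_L`
  have hcond' : (100 * (P'.degree : ℝ) * (P'.htFalt + C₇ * (P'.degree : ℝ) ^ ε) ≤ l ∧ P'.HasMultPlace) ∨
      (D.Mem P' ∧ ∀ w : HeightOneSpectrum (𝓞 L'), P'.W.HasMultiplicativeReductionAt w →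
        ¬ ((l : ℤ) ∣ P'.localHeight w)) := by
    rcases hcond with ⟨hlA, hpot⟩ | ⟨hmem, hcop, h30⟩
    · refine Or.inl ⟨?_, ?_⟩
      · rw [hdeg', hFalt']
        exact condA_transfer hε hC₇ hCC₇ hk1 hk hd hl0 hlA
      · obtain ⟨w, hw⟩ := P.hasPotMultPlace_baseChange L' hpot
        exact ⟨w, hmult_of_pot w hw⟩
    · refine Or.inr ⟨P.mem_baseChange L' D hmem, fun w hw => ?_⟩
      have hpos := P'.localHeight_pos_of_hasMultiplicativeReductionAt w hw
      have hv : P.IsPotMult (Literature.IUT.LogVolume.finBelow P.F L' w) :=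
        (P.isPotMult_baseChange_iff L' w).mp hpos
      refine P.not_dvd_localHeight_baseChange L' hl w (hcop _ hv) ?_
      exact not_dvd_ramificationIdx'_finBelow P.F L' (not_dvd_of_coprime_thirty hl h30 hdeg) w
  -- no `l`-cyclic subgroup scheme over `L′` (Lemma 3.7, last clause, with `[E] ∉ Exc`)
  have hno' : ¬ P'.AdmitsLCyclic l := fun hcyc => hExc' (h37c (by
    rcases hcond' with hA | hB
    · exact Or.inl hA
    · exact Or.inr hB) hcyc)
  -- a multiplicative prime `w₀` of `E_{L′}` with `l ∤ h_{w₀}`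
  obtain ⟨w₀, hw₀, hndvd⟩ : ∃ w : HeightOneSpectrum (𝓞 L'), P'.W.HasMultiplicativeReductionAt w ∧
      ¬ ((l : ℤ) ∣ P'.localHeight w) := by
    rcases hcond' with ⟨hlA, ⟨w, hw⟩⟩ | ⟨hmem, hcop⟩
    · exact ⟨w, hw, P'.not_dvd_localHeight_of_lt w hw (h37a ⟨hlA, ⟨w, hw⟩⟩ w hw)⟩
    · obtain ⟨w, hw⟩ := h37b ⟨hmem, hcop⟩ hExc'
      exact ⟨w, hw, hcop w hw⟩
  have h5l : 5 ≤ l := by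
    rcases hcond with ⟨hlA, -⟩ | ⟨-, -, h30⟩
    · -- `l ≥ 23040·100·d·(h + C d^ε) ≥ 2304000`
      have hh : 1 ≤ P.htFalt + C * (P.degree : ℝ) ^ ε := by
        have hdε : (1 : ℝ) ≤ (P.degree : ℝ) ^ ε := Real.one_le_rpow hd hε.le
        have hlb := hFalt_lb P
        have : C ≤ C * (P.degree : ℝ) ^ ε := le_mul_of_one_le_right hCpos.le hdε
        rw [hCdef] at this ⊢
        nlinarith [mul_pos hC₇ h23040]
      have : (5 : ℝ) ≤ l := by nlinarith
      exact_mod_cast this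
    · exact five_le_of_coprime_thirty hl h30
  have hl2 : l ≠ 2 := by omega
  -- `l ∤ ord_{w₀}(Δ_min)` from `l ∤ h_{w₀}`
  have hndvd' : ¬ l ∣ P'.W.ordMinimalDiscriminant w₀ := by
    rw [← P'.W.natCast_dvd_log_valuation_j_iff w₀ hw₀ l, ← P'.localHeight_eq_log w₀]
    exact hndvd
  -- an element of order `l` on `E_{L′}[l]`: the tree at `w₀ ∤ l` (Kodaira–Néron route, abc-iut-S5),
  -- and at `w₀ ∣ l` the Tate-form transvection with ARBITRARY ramification `e(w₀ ∣ l)`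
  -- (`exists_orderOf_galoisRepTorsion_eq_of_hasMultiplicativeReductionAt_of_mem`, this seat)
  have hord : ∃ σ : Field.absoluteGaloisGroup L', orderOf (P'.W.galoisRepTorsion (l : ℤ) σ) = l := by
    by_cases hwl : ((l : ℕ) : 𝓞 L') ∈ w₀.asIdeal
    · obtain ⟨σ, -, hσ⟩ :=
        P'.W.exists_orderOf_galoisRepTorsion_eq_of_hasMultiplicativeReductionAt_of_mem hw₀ hl hl2
          hwl hndvd'
      exact ⟨σ, hσ⟩
    · obtain ⟨σ, -, hσ⟩ :=
        P'.W.exists_orderOf_galoisRepTorsion_eq_of_hasMultiplicativeReductionAt_of_not_dvd hw₀ hl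
          hwl hndvd'
      exact ⟨σ, hσ⟩
  -- `SL₂(𝔽_l) ⊆ Im(Γ_{L′})`, then `SL₂(ℤ/lⁿ) ⊆ Im(Γ_{L′})` (`l ≥ 5`), then descend to `Γ_L`
  have hSL' : P'.ImageModLContainsSL2 l :=
    P'.imageModLContainsSL2_of_not_admitsLCyclic_of_orderOf_eq l hno' hord
  have hlad' : P'.LAdicImageContainsSL2 l := P'.lAdicImageContainsSL2_of_imageModLContainsSL2 l h5l hSL'
  exact P.lAdicImageContainsSL2_of_baseChange L' l hlad' n hn

/-- The hypothesis `hγ` of `GenEll_thm38_of_localTransvection` for an ODD prime `l`, in `EllPoint`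
currency: for a presented elliptic curve `Q`, a prime `w ∣ l` of multiplicative reduction with
`l ∤ h_w` (the local height `h_w = ord_w Δ_min = -ord_w j`), some `σ ∈ Gal(Q̄/F)` acts on `E[l]` with
order exactly `l` — the Tate transvection at the residue characteristic, ANY ramification index
`e(w ∣ l)` (`WeierstrassCurve.exists_orderOf_galoisRepTorsion_eq_of_hasMultiplicativeReductionAt_of_mem`
through the dictionary `localHeight_eq_log` / `natCast_dvd_log_valuation_j_iff`).  (`l = 2` is outside
Silverman's statement "`ℓ ≥ 3`" and is not needed by Theorem 3.8, which has `l ≥ 5`.)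
[cite: SilvermanATAEC1994, V.6 Prop. 6.1 (p. 410)] [cite: MochizukiGenEll2010, Thm 3.8 p.20] -/
theorem EllPoint.exists_orderOf_galoisRepTorsion_eq_of_mem_of_not_dvd_localHeight (Q : EllPoint)
    {l : ℕ} (hl : l.Prime) (hl2 : l ≠ 2) (w : HeightOneSpectrum (𝓞 Q.F))
    (hw : Q.W.HasMultiplicativeReductionAt w) (hwl : (l : 𝓞 Q.F) ∈ w.asIdeal)
    (hndvd : ¬ ((l : ℤ) ∣ Q.localHeight w)) :
    ∃ σ : Field.absoluteGaloisGroup Q.F, orderOf (Q.W.galoisRepTorsion (l : ℤ) σ) = l := by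
  have hndvd' : ¬ l ∣ Q.W.ordMinimalDiscriminant w := by
    rw [← Q.W.natCast_dvd_log_valuation_j_iff w hw l, ← Q.localHeight_eq_log w]
    exact hndvd
  obtain ⟨σ, -, hσ⟩ :=
    Q.W.exists_orderOf_galoisRepTorsion_eq_of_hasMultiplicativeReductionAt_of_mem hw hl hl2 hwl hndvd'
  exact ⟨σ, hσ⟩

/-- **[GenEll] Corollary 4.3 (Full Galois Actions for Degenerating Elliptic Curves), unconditional**:
the named statement `GenEll_cor43` of `GenEllPrimesPrescribed.lean` (primes `l∘, l• ∉ S` prime to the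
potentially-multiplicative data with `Im ⊇ SL₂(ℤ_{l∘})`, `ρ_{l•}` surjective, and the printed size
bounds), from `GenEll_thm38_holds` by S-d3's `GenEll_cor43_of_thm38`.
[cite: MochizukiGenEll2010, Cor 4.3 p.22] -/
theorem GenEll_cor43_holds : Literature.NumberTheory.DiophantineGeometry.GenEll.GenEll_cor43 :=
  GenEll_cor43_of_thm38 GenEll_thm38_holds

/-- **[GenEll] Corollary 4.4 (Full Galois Actions for Compactly Bounded Subsets), unconditional**: the
named statement `GenEll_cor44` of `GenEllPrimesPrescribed.lean` (for `[E_L] ∈ K_V` compactly bounded: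
primes `l∘, l• ∉ S` as in Cor. 4.3 with the bounds `23040·100d·ht^Falt + 2x_S + C·d` etc., including
the correction [IUTchIV] Rmk. 2.3.1 (iii)(iv)), from `GenEll_thm38_holds` by S-d3's
`GenEll_cor44_of_thm38`.  This is the form in which [IUTchIV] Cor. 2.2 selects its prime `l`.
[cite: MochizukiGenEll2010, Cor 4.4 p.23] -/
theorem GenEll_cor44_holds : Literature.NumberTheory.DiophantineGeometry.GenEll.GenEll_cor44 :=
  GenEll_cor44_of_thm38 GenEll_thm38_holds


end Literature.NumberTheory.DiophantineGeometry.GenEll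

end
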